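import Literature.AlgebraicGeometry.Resolution.ArithmeticalThreefoldsLocalDescentMonomialization
import Literature.AlgebraicGeometry.Resolution.EmbeddedResolutionExcellentSurfacesCor15
import HarnessLib

/-!
# Cossart–Piltant 2019, (C4) `CossartPiltant2019ReductionP`: the chain keyed on the printed facts, modulo equivariant local uniformization

Topic: `Literature/AlgebraicGeometry/Resolution`. PROOF side of `CossartPiltant2019ReductionP`
(`ArithmeticalThreefoldsLocal.lean`), input (C4). `cossartPiltant2019ReductionP_of_cjs_of_stableInertia`
(`ArithmeticalThreefoldsLocalDescentMonomialization.lean`) derives the reduction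
`(Thm. 1.5) ⇒ (LU for complete local domains of residue characteristic p)` (Cossart–Piltant 2019,
Prop. 4.10) from the local theorem, principalization (Prop. 4.4), resolution of excellent surfaces
(Cossart–Jannsen–Saito Thm. 1.2), embedded resolution of surfaces in the custom shape `hEmb`
(Cossart–Jannsen–Saito Cor. 1.5) and the two equivariant-local-uniformization hypotheses
`hStabLoc`, `hStabIη`. This file replaces `hEmb` by the keyed named fact
`CossartJannsenSaito2020Embedded` (CJS Thm. 1.4 with `B = ∅`), using
`CossartJannsenSaito2020Embedded.cor15` (`EmbeddedResolutionExcellentSurfacesCor15.lean`):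
`cossartPiltant2019ReductionP_of_printed_of_stableInertia :
CossartPiltant2019Local → CossartPiltant2019Principalization → CossartJannsenSaito2020General →
CossartJannsenSaito2020Embedded → hStabLoc → hStabIη → CossartPiltant2019ReductionP`.
So, along Cossart–Piltant's own architecture, input (C4) of their Thm. 1.1 rests on four printed
theorems and on exactly two statements not found in print — both instances of EQUIVARIANT local
uniformization for a finite group fixing the valuation: `hStabLoc` ([CoP1] Lemma 9.4, "S is
stable by G", HAL hal-00139124 p. 29) and `hStabIη` (the inertia-layer descent, CP 2019 arXiv v1
p. 54, "an easy adaptation of [CoP1] proposition 9.3").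

Everything is PROVED; no named facts, definitions, instances or notation are introduced.

## Sources

* V. Cossart, O. Piltant, J. Algebra 529 (2019): Props. 4.3, 4.4 and proof of Prop. 4.10
  (arXiv v1: Props. 4.2, 4.3, 4.8, pp. 50–54). [CossartPiltant2019]
* V. Cossart, O. Piltant, J. Algebra 320 (2008): Prop. 4.1, Prop. 8.1, Prop. 9.3, Lemma 9.4 and
  their proofs (HAL hal-00139124, pp. 6–7, 22–23, 26–30). [CossartPiltant2008]
* V. Cossart, U. Jannsen, S. Saito, LNM 2270 (2020): Thm. 1.2, Thm. 1.4, Cor. 1.5. [CossartJannsenSaito2020]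
-/

noncomputable section

open CategoryTheory AlgebraicGeometry TopologicalSpace IsLocalRing _root_.Polynomial
  _root_.IntermediateField

namespace Literature.AlgebraicGeometry.Resolution

universe u

set_option maxHeartbeats 800000 in
/-- **The chain for (C4), keyed on the printed facts**: the local theorem (CP 2019 Thm. 1.5),
principalization (Prop. 4.4), Cossart–Jannsen–Saito Thm. 1.2 and Thm. 1.4 (`B = ∅`), and the two
equivariant local-uniformization hypotheses `hStabLoc` (tame layer) and `hStabIη` (inertia
layer) give `CossartPiltant2019ReductionP`.
[cite: CossartPiltant2019, Props. 4.3, 4.4 and proof of Prop. 4.10 (arXiv v1: Props. 4.2, 4.3, 4.8, pp. 50–54)]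
[cite: CossartPiltant2008, Prop. 8.1, Prop. 9.3, Lemma 9.4 and their proofs (HAL pp. 22–23, 26–30)]
[cite: CossartJannsenSaito2020, Thm. 1.2, Thm. 1.4, Cor. 1.5] -/
theorem cossartPiltant2019ReductionP_of_printed_of_stableInertia
    (hloc : CossartPiltant2019Local.{u}) (h44 : CossartPiltant2019Principalization.{u})
    (hCJS : CossartJannsenSaito2020General.{u}) (hCJSE : CossartJannsenSaito2020Embedded.{u})
    (hStabLoc :
      ∀ (p : ℕ), p.Prime →
      ∀ (S : Type u) [CommRing S] [IsDomain S] [IsRegularLocalRing S],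
        IsExcellentRing S → ringKrullDim S = 3 → CharP (ResidueField S) p →
        IsAdicComplete (maximalIdeal S) S →
      ∀ (E : Type u) [Field E] [Algebra S E], Function.Injective (algebraMap S E) →
        IsAlgClosed E → Algebra.IsAlgebraic S E →
      ∀ (OE : ValuationSubring E), (∀ s : S, algebraMap S E s ∈ OE) →
        (∀ s ∈ maximalIdeal S, OE.valuation (algebraMap S E s) < 1) →
        (∀ y : OE, ∃ q : S[X], (∃ i, q.coeff i ∉ maximalIdeal S) ∧
          OE.valuation (q.eval₂ (algebraMap S E) y) < 1) →
      Nonempty OE.valuation.RankOne →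
      ∀ (ℓ : ℕ), ℓ.Prime → ℓ ≠ p → ∀ (ζ : E), IsPrimitiveRoot ζ ℓ →
      ∀ (A : Subfield E), (∀ s : S, algebraMap S E s ∈ A) → ζ ∈ A →
      ∀ (θ : E), θ ∉ A → θ ^ ℓ ∈ A → OE.valuation θ ≤ 1 →
        Module.finrank A (adjoin A ({θ} : Set E)) = ℓ → IsGalois A (adjoin A ({θ} : Set E)) →
        inertiaGroupIn OE (adjoin A ({θ} : Set E)) = ⊤ →
        (∃ t : Finset E, (t : Set E) ⊆ (adjoin A ({θ} : Set E)).toSubfield ∧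
          (adjoin A ({θ} : Set E)).toSubfield ≤
            Subfield.closure (Set.range (algebraMap S E) ∪ (t : Set E)) ∧
          ∃ hTO : (Algebra.adjoin S (t : Set E)).toSubring ≤ OE.toSubring,
            IsRegularLocalRing (Localization.AtPrime
              (Ideal.comap (Subring.inclusion hTO) (maximalIdeal OE)))) →
        (∃ t : Finset E, (t : Set E) ⊆ (adjoin A ({θ} : Set E)).toSubfield ∧
          (adjoin A ({θ} : Set E)).toSubfield ≤
            Subfield.closure (Set.range (algebraMap S E) ∪ (t : Set E)) ∧
          ∃ hTO : (Algebra.adjoin S (t : Set E)).toSubring ≤ OE.toSubring,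
            IsRegularLocalRing (Localization.AtPrime
              (Ideal.comap (Subring.inclusion hTO) (maximalIdeal OE))) ∧
            ∀ (τ : adjoin A ({θ} : Set E) ≃ₐ[A] adjoin A ({θ} : Set E))
              (x : adjoin A ({θ} : Set E)),
              (x : E) ∈ locAtCentre (Algebra.adjoin S (t : Set E)).toSubring OE →
              ((τ x : adjoin A ({θ} : Set E)) : E) ∈
                locAtCentre (Algebra.adjoin S (t : Set E)).toSubring OE))
    (hStabIη :
      ∀ (p : ℕ), p.Prime →
      ∀ (S : Type u) [CommRing S] [IsDomain S] [IsRegularLocalRing S],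
        IsExcellentRing S → ringKrullDim S = 3 → CharP (ResidueField S) p →
        IsAdicComplete (maximalIdeal S) S →
      ∀ (E : Type u) [Field E] [Algebra S E], Function.Injective (algebraMap S E) →
        IsAlgClosed E → Algebra.IsAlgebraic S E →
      ∀ (OE : ValuationSubring E), (∀ s : S, algebraMap S E s ∈ OE) →
        (∀ s ∈ maximalIdeal S, OE.valuation (algebraMap S E s) < 1) →
        (∀ y : OE, ∃ q : S[X], (∃ i, q.coeff i ∉ maximalIdeal S) ∧
          OE.valuation (q.eval₂ (algebraMap S E) y) < 1) →
      Nonempty OE.valuation.RankOne →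
      ∀ (M : Subfield E), (∀ s : S, algebraMap S E s ∈ M) →
      ∀ (N : IntermediateField M E) [FiniteDimensional M N] [IsGalois M N],
      ∀ (η : E), η ∈ OE → η ∈ (lift (fixedField (inertiaGroupIn OE N))).toSubfield →
        (∃ F : Polynomial E, F.Monic ∧
          (∀ k, F.coeff k ∈ OE ∧
            F.coeff k ∈ (lift (fixedField (decompositionGroupIn OE N))).toSubfield) ∧
          F.eval η = 0 ∧ OE.valuation ((derivative F).eval η) = 1) →
        (lift (fixedField (inertiaGroupIn OE N))).toSubfield =
          (IntermediateField.adjoin (lift (fixedField (decompositionGroupIn OE N))).toSubfield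
            ({η} : Set E)).toSubfield →
        (∃ t : Finset E, (t : Set E) ⊆ (lift (fixedField (inertiaGroupIn OE N))).toSubfield ∧
          (lift (fixedField (inertiaGroupIn OE N))).toSubfield ≤
            Subfield.closure (Set.range (algebraMap S E) ∪ (t : Set E)) ∧
          ∃ hTO : (Algebra.adjoin S (t : Set E)).toSubring ≤ OE.toSubring,
            IsRegularLocalRing (Localization.AtPrime
              (Ideal.comap (Subring.inclusion hTO) (maximalIdeal OE)))) →
        ∃ t : Finset E, (t : Set E) ⊆ (lift (fixedField (inertiaGroupIn OE N))).toSubfield ∧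
          (lift (fixedField (inertiaGroupIn OE N))).toSubfield ≤
            Subfield.closure (Set.range (algebraMap S E) ∪ (t : Set E)) ∧
          ∃ hTO : (Algebra.adjoin S (t : Set E)).toSubring ≤ OE.toSubring,
            IsRegularLocalRing (Localization.AtPrime
              (Ideal.comap (Subring.inclusion hTO) (maximalIdeal OE))) ∧
            (∀ τ ∈ decompositionGroupIn OE N, ∀ x : N,
              (x : E) ∈ locAtCentre (Algebra.adjoin S (t : Set E)).toSubring OE →
              ((τ x : N) : E) ∈ locAtCentre (Algebra.adjoin S (t : Set E)).toSubring OE) ∧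
            η ∈ locAtCentre (Algebra.adjoin S (t : Set E)).toSubring OE) :
    CossartPiltant2019ReductionP.{u} :=
  cossartPiltant2019ReductionP_of_cjs_of_stableInertia hloc h44 hCJS
    (CossartJannsenSaito2020Embedded.cor15 hCJSE) hStabLoc hStabIη

end Literature.AlgebraicGeometry.Resolution

end
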